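import Summits.BirchSwinnertonDyer.BirchSwinnertonDyer.Theorems.PrintCf2RamifiedOffTYZQFormPsi
import Summits.BirchSwinnertonDyer.BirchSwinnertonDyer.Theorems.PrintCf2RamifiedOffTYZQFormKerSum
import Literature.NumberTheory.EllipticCurves.Smith2016.CongruentNumberGenusSumSixDecompositions
import HarnessLib

/-!
# Route `PrintCf2`, crux stmt-BirchSwinnertonDyer-20509 `RamifiedOffTYZOfFacts` — the Q-form identity (★) FOR MONSKY'S MATRIX (F4)
# (cell `bsd-print-cf2`, LEAD of 20509 g6, line `offtyz-v7`, cycle 7; kernel helpers `--supports stmt-BirchSwinnertonDyer-20509`)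

Last file of this cycle's kernel proof of g5's conjecture (★) `Q_n = q(κ_n)` (crux workfile
`Cruxes/RamifiedOffTYZOfFacts/Lines/offtyz_v7_QFormProof.md` §1–§4): the bridge from the abstract forest identities (`…QFormForest`,
`…Cofactors`, `…Pinned`, `…KeyLemma`, `…Psi`) to MONSKY'S odd matrix `M_n = monskyMatrixOdd p` (Heath-Brown 1994, appendix) for
`n = p₁⋯p_k ≡ 5 (mod 8)`.

* `hrec_legendreT`, `sum_erase_legendreMatrix_col`, `bigN_legendreT_eq`, `one_vecMul_bigN_legendreT` — quadratic reciprocity as the reciprocity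
  law of the transposed additive Legendre weights `aᵀ s t = A_{ts}`, and **`bigN aᵀ univ z z z = J·M_n + (0;y)(y;0)ᵀ`** (`J` the block swap,
  `z = ((2/pᵢ)₊)`, `y = ((−1/pᵢ)₊)`, `Σ y = 0`): the symmetric doubled forest matrix IS Monsky's matrix up to a block swap and a rank-one term
  that vanishes on both kernels, whence `monskyMatrixOdd_mulVec_eq_zero_iff_bigN` (**same kernel**).
* **`kerSum_monsky_inr_eq_sum_admissible`** — (★b): `κ_n(inr t) = Σ_{B ∋ t, Σ_B y = 0, Σ_B z = 1} κ_t^{aᵀ}(B) · det bigN aᵀ(univ∖B)`, where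
  `κ_n = Σ_{v ∈ ker M_n} v` is Monsky's kernel sum (g5's `QForm.kappa`; `QForm.kappaB p t = κ_n (inr t)`);
  **`kerSum_monsky_four_eq_sum_admissible`** — (★a): `κ_n(inl s) + κ_n(inr s) + κ_n(inl t) + κ_n(inr t) =
  Σ_{B ∋ s,t, Σ_B y = 0, Σ_B z = 1} (κ_s^{aᵀ} + κ_t^{aᵀ})(B) · det bigN aᵀ(univ∖B)`;
  `admissible_iff_prod_mod_eight` — the admissible blocks are exactly `d_B ≡ 5 (mod 8)`, and the two identities restated with that filter
  (`…_mod_eight`). On admissible blocks `κ_t^{aᵀ}(B) = ρ(N_B)_t` (`QForm.blockRho`) and `det bigN aᵀ(T) = det M_T` (`QForm.coblockWeight`) —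
  that literal re-indexing to g5's `QForm.rhsB` / `rhsA` (sub-tuples `blockPrimes`) is left to the next file; the MATHEMATICS of (★) is complete
  here. Consequence (paper level, g5 §6 + the Galois-mover door p672160): for every square-free `n ≡ 5 (mod 8)` with `#Sel₂(E_n) = 8`,
  `𝓛(n)` is odd, `ord_{s=1} L(E_n,s) = rank = 1`, `Ш[2^∞] = 0`, `BSD(E_n,2)` — modulo TYZ §3 as displayed + CFT.
Pure linear algebra over `𝔽₂`; no `sorry`. BSD is not proved by any of this; no class is closed.

References: [cite: HeathBrown1994SelmerCongruentII, Appendix (Monsky), typescript p. 39 L10 – p. 40 L31]; [cite: Chaiken1982, §2];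
[cite: Smith2016CongruentDensity, §2].
-/

namespace Summit.BirchSwinnertonDyer.PrintCf2.QFormForest

open Matrix Finset Literature.LinearAlgebra.Matrix Literature.Combinatorics.Enumerative
open Literature.NumberTheory.EllipticCurves.Smith2016

variable {V : Type*} [Fintype V] [LinearOrder V]


section Monsky

open Literature.NumberTheory.EllipticCurves.HeathBrown1994 Literature.NumberTheory.EllipticCurves.MonskySelmerParity

variable {k : ℕ} (p : Fin k → ℕ) (hp : ∀ i, (p i).Prime) (hp2 : ∀ i, p i ≠ 2) (hinj : Function.Injective p)

include hp hp2 hinj in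
/-- **Quadratic reciprocity as the reciprocity law of the TRANSPOSED additive Legendre matrix**: with `aᵀ s t := A_{ts}` and
`y_t = (−1/p_t)₊`, `aᵀ s t + aᵀ t s = y_s y_t` for `s ≠ t` (Monsky's (31)). [cite: HeathBrown1994SelmerCongruentII, Appendix (Monsky), typescript p. 39 L36–L41] -/
theorem hrec_legendreT : ∀ i ∈ (univ : Finset (Fin k)), ∀ j ∈ (univ : Finset (Fin k)), i ≠ j →
    legendreMatrix p j i + legendreMatrix p i j = addLegendreSym (-1) (p i) * addLegendreSym (-1) (p j) := by
  intro i _ j _ hij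
  have h := congrFun (congrFun (legendreMatrix_add_transpose p hp hp2 hinj) i) j
  rw [Matrix.add_apply, transpose_apply, Matrix.add_apply, vecMulVec_apply, legendreDiagonal, diagonal_apply_ne _ hij,
    zero_add] at h
  rw [add_comm]; exact h

include hp hp2 hinj in
/-- Column sums of Monsky's `A` when `Σ (−1/pᵢ)₊ = 0` (`n ≡ 1 (mod 4)`): `Σ_{l ≠ i} A_{li} = A_{ii} + yᵢ`.
[cite: HeathBrown1994SelmerCongruentII, Appendix (Monsky), typescript p. 39 L34–L41] -/
theorem sum_erase_legendreMatrix_col (h4 : ∑ i, addLegendreSym (-1) (p i) = 0) (i : Fin k) :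
    ∑ l ∈ univ.erase i, legendreMatrix p l i = legendreMatrix p i i + addLegendreSym (-1) (p i) := by
  have h := congrFun (one_vecMul_legendreMatrix p hp hp2 hinj) i
  rw [h4, add_zero, one_smul, vecMul] at h
  change ∑ l, (1 : ZMod 2) * legendreMatrix p l i = _ at h
  simp only [one_mul] at h
  rw [← add_sum_erase univ _ (mem_univ i)] at h
  have h2 : ∀ u v w : ZMod 2, u + v = w → v = u + w := by decide
  exact h2 _ _ _ h

include hp hp2 hinj in
/-- **The symmetric doubled form of Monsky's odd matrix** (note §1 (1a)): for `Σ (−1/pᵢ)₊ = 0`,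
`bigN aᵀ univ z z z = J·M + (0; y)(y; 0)ᵀ` with `J` the block swap, `M = monskyMatrixOdd p`, `z = ((2/pᵢ)₊)`, `y = ((−1/pᵢ)₊)`
(the mirror image of the tree's `swap_mul_monskyMatrixOdd` for the transposed weights; the transposed Laplacian has COLUMN sums of `A` on the
diagonal, `= A_ii + y_i`). [cite: HeathBrown1994SelmerCongruentII, Appendix (Monsky), typescript p. 39 L27–L41] -/
theorem bigN_legendreT_eq (h4 : ∑ i, addLegendreSym (-1) (p i) = 0) :
    bigN (fun i j => legendreMatrix p j i) univ (fun i => addLegendreSym 2 (p i)) (fun i => addLegendreSym 2 (p i))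
        (fun i => addLegendreSym 2 (p i)) =
      fromBlocks (legendreDiagonal p 2) (legendreMatrix p + legendreDiagonal p (-2))
          (legendreMatrix p + legendreDiagonal p 2) (legendreDiagonal p 2) +
        vecMulVec (Sum.elim (0 : Fin k → ZMod 2) (fun i => addLegendreSym (-1) (p i)))
          (Sum.elim (fun i => addLegendreSym (-1) (p i)) (0 : Fin k → ZMod 2)) := by
  have hcol := sum_erase_legendreMatrix_col p hp hp2 hinj h4
  have hrec := hrec_legendreT p hp hp2 hinj
  have hsq : ∀ u : ZMod 2, u * u = u := by decide
  rw [legendreDiagonal_neg_two p hp hp2]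
  ext (i | i) (j | j)
  · rw [bigN_inl_inl, Matrix.add_apply, fromBlocks_apply₁₁, vecMulVec_apply, Sum.elim_inl, Sum.elim_inl, legendreDiagonal,
      diagonal_apply, Pi.zero_apply, zero_mul, add_zero]
    simp
  · rw [bigN_inl_inr, lapIn_apply, Matrix.add_apply, fromBlocks_apply₁₂, vecMulVec_apply, Sum.elim_inl, Pi.zero_apply, zero_mul,
      add_zero, Matrix.add_apply, Matrix.add_apply, legendreDiagonal, legendreDiagonal, diagonal_apply, diagonal_apply]
    simp only [mem_univ, and_self, if_true]
    by_cases hij : i = j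
    · subst hij; rw [if_pos rfl, if_pos rfl, if_pos rfl, hcol]; ring
    · rw [if_neg (Ne.symm hij), if_neg hij, if_neg hij, add_zero, add_zero]
  · rw [bigN_inr_inl, lapIn_apply, Matrix.add_apply, fromBlocks_apply₂₁, vecMulVec_apply, Sum.elim_inr, Sum.elim_inl,
      Matrix.add_apply, legendreDiagonal, diagonal_apply]
    simp only [mem_univ, and_self, if_true]
    by_cases hij : i = j
    · subst hij; rw [if_pos rfl, if_pos rfl, hcol, hsq]; ring
    · rw [if_neg hij, if_neg hij, add_zero]
      have h3 : ∀ u v w : ZMod 2, u + v = w → u = v + w := by decide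
      exact h3 _ _ _ (hrec i (mem_univ _) j (mem_univ _) hij)
  · rw [bigN_inr_inr, Matrix.add_apply, fromBlocks_apply₂₂, vecMulVec_apply, Sum.elim_inr, Sum.elim_inr, legendreDiagonal,
      diagonal_apply, Pi.zero_apply, mul_zero, add_zero]
    simp

/-- The block swap times Monsky's odd matrix. [cite: HeathBrown1994SelmerCongruentII, Appendix (Monsky), typescript p. 39 L27–L32] -/
theorem swap_mul_monskyMatrixOdd_eq :
    fromBlocks (0 : Matrix (Fin k) (Fin k) (ZMod 2)) (1 : Matrix (Fin k) (Fin k) (ZMod 2))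
        (1 : Matrix (Fin k) (Fin k) (ZMod 2)) (0 : Matrix (Fin k) (Fin k) (ZMod 2)) * monskyMatrixOdd p =
      fromBlocks (legendreDiagonal p 2) (legendreMatrix p + legendreDiagonal p (-2))
        (legendreMatrix p + legendreDiagonal p 2) (legendreDiagonal p 2) := by
  rw [monskyMatrixOdd, fromBlocks_multiply]
  simp

include hp hp2 hinj in
/-- `𝟙ᵀ · bigN aᵀ z z z = (y; 0)` when `Σ y = 0` (row sums of `A` vanish, column sums are `y`).
[cite: HeathBrown1994SelmerCongruentII, Appendix (Monsky), typescript p. 39 L34–L41] -/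
theorem one_vecMul_bigN_legendreT (h4 : ∑ i, addLegendreSym (-1) (p i) = 0) :
    (1 : Fin k ⊕ Fin k → ZMod 2) ᵥ*
      bigN (fun i j => legendreMatrix p j i) univ (fun i => addLegendreSym 2 (p i)) (fun i => addLegendreSym 2 (p i))
        (fun i => addLegendreSym 2 (p i)) =
      Sum.elim (fun i => addLegendreSym (-1) (p i)) 0 := by
  rw [bigN_legendreT_eq p hp hp2 hinj h4, legendreDiagonal_neg_two p hp hp2, vecMul_add, vecMul_fromBlocks, one_vecMul_vecMulVec,
    Fintype.sum_sum_type]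
  simp only [Sum.elim_inl, Sum.elim_inr, Pi.zero_apply, sum_const_zero, h4, zero_smul, add_zero]
  have h1l : ((1 : Fin k ⊕ Fin k → ZMod 2) ∘ Sum.inl) = (1 : Fin k → ZMod 2) := rfl
  have h1r : ((1 : Fin k ⊕ Fin k → ZMod 2) ∘ Sum.inr) = (1 : Fin k → ZMod 2) := rfl
  rw [h1l, h1r]
  simp only [vecMul_add, one_vecMul_legendreMatrix p hp hp2 hinj, h4, add_zero, one_smul, one_vecMul_legendreDiagonal]
  ext (i | i)
  · simp only [Sum.elim_inl, Pi.add_apply]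
    generalize addLegendreSym (-1) (p i) = u
    generalize addLegendreSym 2 (p i) = v
    revert u v; decide
  · simp only [Sum.elim_inr, Pi.add_apply, Pi.zero_apply]
    generalize addLegendreSym (-1) (p i) = u
    generalize addLegendreSym 2 (p i) = v
    revert u v; decide

include hp hp2 hinj in
/-- **`ker M = ker N`** (note §1 (1b)): Monsky's odd matrix and its symmetric doubled form `N = bigN aᵀ univ z z z` have the same kernel when
`Σ (−1/pᵢ)₊ = 0` — the rank-one difference `(0;y)(y;0)ᵀ` vanishes on both kernels (`y·a = 𝟙ᵀ N v`).
[cite: HeathBrown1994SelmerCongruentII, Appendix (Monsky), typescript p. 39 L27 – p. 40 L24] -/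
theorem monskyMatrixOdd_mulVec_eq_zero_iff_bigN (h4 : ∑ i, addLegendreSym (-1) (p i) = 0) (v : Fin k ⊕ Fin k → ZMod 2) :
    monskyMatrixOdd p *ᵥ v = 0 ↔
      bigN (fun i j => legendreMatrix p j i) univ (fun i => addLegendreSym 2 (p i)) (fun i => addLegendreSym 2 (p i))
        (fun i => addLegendreSym 2 (p i)) *ᵥ v = 0 := by
  set N := bigN (fun i j => legendreMatrix p j i) univ (fun i => addLegendreSym 2 (p i)) (fun i => addLegendreSym 2 (p i))
        (fun i => addLegendreSym 2 (p i)) with hN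
  set J := fromBlocks (0 : Matrix (Fin k) (Fin k) (ZMod 2)) (1 : Matrix (Fin k) (Fin k) (ZMod 2))
        (1 : Matrix (Fin k) (Fin k) (ZMod 2)) (0 : Matrix (Fin k) (Fin k) (ZMod 2)) with hJ
  set yv : Fin k → ZMod 2 := fun i => addLegendreSym (-1) (p i) with hyv
  have hNE : N = J * monskyMatrixOdd p + vecMulVec (Sum.elim 0 yv) (Sum.elim yv 0) := by
    rw [hN, bigN_legendreT_eq p hp hp2 hinj h4, hJ, swap_mul_monskyMatrixOdd_eq]
  have hJJ : J * J = 1 := by rw [hJ, fromBlocks_multiply]; simp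
  have hc : ∀ w, Sum.elim yv 0 ⬝ᵥ w = (1 : Fin k ⊕ Fin k → ZMod 2) ⬝ᵥ (N *ᵥ w) := by
    intro w; rw [dotProduct_mulVec, hN, one_vecMul_bigN_legendreT p hp hp2 hinj h4]
  have hE : ∀ w : Fin k ⊕ Fin k → ZMod 2, vecMulVec (Sum.elim (0 : Fin k → ZMod 2) yv) (Sum.elim yv 0) *ᵥ w =
      (Sum.elim yv 0 ⬝ᵥ w) • Sum.elim (0 : Fin k → ZMod 2) yv := by
    intro w; ext i
    simp only [mulVec, dotProduct, vecMulVec_apply, Pi.smul_apply, smul_eq_mul]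
    rw [Finset.sum_mul]
    exact Finset.sum_congr rfl fun j _ => by ring
  have hNv : N *ᵥ v = J *ᵥ (monskyMatrixOdd p *ᵥ v) + (Sum.elim yv 0 ⬝ᵥ v) • Sum.elim (0 : Fin k → ZMod 2) yv := by
    rw [hNE, add_mulVec, hE, mulVec_mulVec]
  have hsumy : (1 : Fin k ⊕ Fin k → ZMod 2) ⬝ᵥ Sum.elim (0 : Fin k → ZMod 2) yv = 0 := by
    rw [one_dotProduct, Fintype.sum_sum_type]
    simp only [Sum.elim_inl, Sum.elim_inr, Pi.zero_apply, sum_const_zero, zero_add, hyv]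
    exact h4
  constructor
  · intro hM
    rw [hM, mulVec_zero, zero_add] at hNv
    have hcv := hc v
    rw [hNv, dotProduct_smul, hsumy, smul_zero] at hcv
    rw [hNv, hcv, zero_smul]
  · intro hN0
    have hcv := hc v
    rw [hN0, dotProduct_zero] at hcv
    rw [hN0, hcv, zero_smul, add_zero] at hNv
    have h := congrArg (fun w => J *ᵥ w) hNv
    simp only [mulVec_zero] at h
    rw [mulVec_mulVec, mulVec_mulVec, hJJ, Matrix.one_mul] at h
    exact h.symm

include hp hp2 in
/-- `∏ pᵢ ≡ 5 (mod 8)` ⟹ `Σ (−1/pᵢ)₊ = 0` and `Σ (2/pᵢ)₊ = 1`. [cite: HeathBrown1994SelmerCongruentII, Appendix (Monsky), typescript p. 39 L36–L37] -/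
theorem sums_of_prod_mod_eight_five (h5 : (∏ i, p i) % 8 = 5) :
    ∑ i, addLegendreSym (-1) (p i) = 0 ∧ ∑ i, addLegendreSym 2 (p i) = 1 := by
  rw [sum_addLegendreSym_neg_one_eq p hp hp2, sum_addLegendreSym_two_eq p hp hp2, if_pos (by omega), if_neg (by omega)]
  exact ⟨rfl, rfl⟩

include hp hp2 hinj in
/-- **(★b) for Monsky's matrix, in forest language** (note §3): for `n = ∏ pᵢ ≡ 5 (mod 8)` and every `t`,
`κ_n(inr t) = Σ_{B ∋ t, Σ_B y = 0, Σ_B z = 1} κ_t^{aᵀ}(B) · det bigN aᵀ (univ∖B) z z z`, where `κ_n = Σ_{v ∈ ker M_n} v` is Monsky's kernel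
sum (g5's `QForm.kappa`, `kappaB p t = κ_n (inr t)`). With the even-block dictionary `κ_t^{aᵀ}(B) = ρ(N_B)_t = blockRho p B t` and
`det bigN aᵀ(T) = det M_T` (kernels agree) this is g5's (★b) `kappaB = rhsB`. [cite: HeathBrown1994SelmerCongruentII, Appendix (Monsky), typescript p. 39 L27–L41]
[cite: Chaiken1982, §2] -/
theorem kerSum_monsky_inr_eq_sum_admissible (h5 : (∏ i, p i) % 8 = 5) (t : Fin k) :
    (∑ v : Fin k ⊕ Fin k → ZMod 2, if monskyMatrixOdd p *ᵥ v = 0 then v else 0) (Sum.inr t) =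
      ∑ B ∈ (univ : Finset (Fin k)).powerset.filter
          (fun B => t ∈ B ∧ (∑ i ∈ B, addLegendreSym (-1) (p i) = 0 ∧ ∑ i ∈ B, addLegendreSym 2 (p i) = 1)),
        treeDet (fun i j => legendreMatrix p j i) B t *
          (bigN (fun i j => legendreMatrix p j i) (univ \ B) (fun i => addLegendreSym 2 (p i))
            (fun i => addLegendreSym 2 (p i)) (fun i => addLegendreSym 2 (p i))).det := by
  obtain ⟨h4, hz⟩ := sums_of_prod_mod_eight_five p hp hp2 h5
  have hker := monskyMatrixOdd_mulVec_eq_zero_iff_bigN p hp hp2 hinj h4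
  simp_rw [hker]
  have hrec := hrec_legendreT p hp hp2 hinj
  have hne : (univ : Finset (Fin k)).Nonempty := nonempty_of_sum_eq_one hz
  rw [kerSum_apply_eq_adjugate _ (bigN_transpose _ _ _ _ _)
      (det_bigN_self_eq_zero _ _ _ univ hrec hne (Or.inr hz)),
    adjugate_bigN_self_inr_inr_eq_sum_admissible _ _ _ hrec h4 (mem_univ t),
    sum_powerset_filter_mem_and_eq _ (mem_univ t)]
  refine sum_congr rfl fun B₀ _ => ?_
  rw [erase_sdiff_eq_sdiff_insert]

include hp hp2 hinj in
/-- **(★a) for Monsky's matrix, in forest language** (note §4): for `n = ∏ pᵢ ≡ 5 (mod 8)` and `s ≠ t`,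
`κ_n(inl s) + κ_n(inr s) + κ_n(inl t) + κ_n(inr t) = Σ_{B ∋ s,t, Σ_B y = 0, Σ_B z = 1} (κ_s^{aᵀ}(B) + κ_t^{aᵀ}(B)) · det bigN aᵀ(univ∖B)`
— with the dictionary of the previous theorem this is g5's (★a) `rhsA p s t = (kappaA + kappaB) s + (kappaA + kappaB) t`.
[cite: HeathBrown1994SelmerCongruentII, Appendix (Monsky), typescript p. 39 L27–L41] [cite: Chaiken1982, §2] -/
theorem kerSum_monsky_four_eq_sum_admissible (h5 : (∏ i, p i) % 8 = 5) {s t : Fin k} (hst : s ≠ t) :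
    (∑ v : Fin k ⊕ Fin k → ZMod 2, if monskyMatrixOdd p *ᵥ v = 0 then v else 0) (Sum.inl s) +
      (∑ v : Fin k ⊕ Fin k → ZMod 2, if monskyMatrixOdd p *ᵥ v = 0 then v else 0) (Sum.inr s) +
      ((∑ v : Fin k ⊕ Fin k → ZMod 2, if monskyMatrixOdd p *ᵥ v = 0 then v else 0) (Sum.inl t) +
        (∑ v : Fin k ⊕ Fin k → ZMod 2, if monskyMatrixOdd p *ᵥ v = 0 then v else 0) (Sum.inr t)) =
      ∑ B ∈ (univ : Finset (Fin k)).powerset.filter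
          (fun B => s ∈ B ∧ t ∈ B ∧ (∑ i ∈ B, addLegendreSym (-1) (p i) = 0 ∧ ∑ i ∈ B, addLegendreSym 2 (p i) = 1)),
        (treeDet (fun i j => legendreMatrix p j i) B s + treeDet (fun i j => legendreMatrix p j i) B t) *
          (bigN (fun i j => legendreMatrix p j i) (univ \ B) (fun i => addLegendreSym 2 (p i))
            (fun i => addLegendreSym 2 (p i)) (fun i => addLegendreSym 2 (p i))).det := by
  obtain ⟨h4, hz⟩ := sums_of_prod_mod_eight_five p hp hp2 h5
  have hker := monskyMatrixOdd_mulVec_eq_zero_iff_bigN p hp hp2 hinj h4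
  simp_rw [hker]
  have hrec := hrec_legendreT p hp hp2 hinj
  have hne : (univ : Finset (Fin k)).Nonempty := nonempty_of_sum_eq_one hz
  have hdet := det_bigN_self_eq_zero (fun i j => legendreMatrix p j i) (fun i => addLegendreSym (-1) (p i))
    (fun i => addLegendreSym 2 (p i)) univ hrec hne (Or.inr hz)
  have hsym := bigN_transpose (fun i j => legendreMatrix p j i) univ (fun i => addLegendreSym 2 (p i))
    (fun i => addLegendreSym 2 (p i)) (fun i => addLegendreSym 2 (p i))
  rw [kerSum_apply_eq_adjugate _ hsym hdet, kerSum_apply_eq_adjugate _ hsym hdet, kerSum_apply_eq_adjugate _ hsym hdet,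
    kerSum_apply_eq_adjugate _ hsym hdet]
  exact adjugate_four_eq_sum_admissible _ _ _ hrec h4 hz (mem_univ s) (mem_univ t) hst


include hp hp2 in
/-- **The admissible blocks are exactly `d_B ≡ 5 (mod 8)`**: `Σ_B (−1/pᵢ)₊ = 0 ∧ Σ_B (2/pᵢ)₊ = 1 ⟺ ∏_B pᵢ ≡ 5 (mod 8)`.
[cite: HeathBrown1994SelmerCongruentII, Appendix (Monsky), typescript p. 39 L36–L37] -/
theorem admissible_iff_prod_mod_eight (B : Finset (Fin k)) :
    (∑ i ∈ B, addLegendreSym (-1) (p i) = 0 ∧ ∑ i ∈ B, addLegendreSym 2 (p i) = 1) ↔ (∏ i ∈ B, p i) % 8 = 5 := by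
  have hodd : ∀ i, Odd (p i) := fun i => (hp i).odd_of_ne_two (hp2 i)
  rw [sum_addLegendreSym_neg_one_block_eq p hp hodd B,
    Literature.NumberTheory.EllipticCurves.HeathBrown1994.Families.sum_addLegendreSym_two_eq B p (fun i _ => Nat.odd_iff.mp (hodd i))]
  constructor
  · rintro ⟨ha, hb⟩
    by_cases h2 : ((∏ i ∈ B, p i) % 8 = 3 ∨ (∏ i ∈ B, p i) % 8 = 5)
    · by_cases h1 : (∏ i ∈ B, p i) % 4 = 1
      · omega
      · rw [if_neg h1] at ha; exact absurd ha one_ne_zero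
    · rw [if_neg h2] at hb; exact absurd hb zero_ne_one
  · intro h5
    have h1 : (∏ i ∈ B, p i) % 4 = 1 := by omega
    have h2 : ((∏ i ∈ B, p i) % 8 = 3 ∨ (∏ i ∈ B, p i) % 8 = 5) := Or.inr h5
    rw [if_pos h1, if_pos h2]
    exact ⟨rfl, rfl⟩

include hp hp2 hinj in
/-- **(★b) for Monsky's matrix with the `mod 8` filter**: `κ_n(inr t) = Σ_{B ∋ t, ∏_B pᵢ ≡ 5 (8)} κ_t^{aᵀ}(B) · det bigN aᵀ(univ∖B)`
(`= Σ_{S ∋ t admissible} blockRho p S t · coblockWeight p S` = `QForm.rhsB p t` after re-indexing the blocks).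
[cite: HeathBrown1994SelmerCongruentII, Appendix (Monsky), typescript p. 39 L27–L41] [cite: Chaiken1982, §2] -/
theorem kerSum_monsky_inr_eq_sum_mod_eight (h5 : (∏ i, p i) % 8 = 5) (t : Fin k) :
    (∑ v : Fin k ⊕ Fin k → ZMod 2, if monskyMatrixOdd p *ᵥ v = 0 then v else 0) (Sum.inr t) =
      ∑ B ∈ (univ : Finset (Fin k)).powerset.filter (fun B => t ∈ B ∧ (∏ i ∈ B, p i) % 8 = 5),
        treeDet (fun i j => legendreMatrix p j i) B t *
          (bigN (fun i j => legendreMatrix p j i) (univ \ B) (fun i => addLegendreSym 2 (p i))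
            (fun i => addLegendreSym 2 (p i)) (fun i => addLegendreSym 2 (p i))).det := by
  rw [kerSum_monsky_inr_eq_sum_admissible p hp hp2 hinj h5 t]
  exact sum_congr (filter_congr fun B _ => by rw [admissible_iff_prod_mod_eight p hp hp2 B]) fun _ _ => rfl

include hp hp2 hinj in
/-- **(★a) for Monsky's matrix with the `mod 8` filter**: for `s ≠ t`,
`κ_n(inl s) + κ_n(inr s) + κ_n(inl t) + κ_n(inr t) = Σ_{B ∋ s,t, ∏_B pᵢ ≡ 5 (8)} (κ_s^{aᵀ} + κ_t^{aᵀ})(B) · det bigN aᵀ(univ∖B)`.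
[cite: HeathBrown1994SelmerCongruentII, Appendix (Monsky), typescript p. 39 L27–L41] [cite: Chaiken1982, §2] -/
theorem kerSum_monsky_four_eq_sum_mod_eight (h5 : (∏ i, p i) % 8 = 5) {s t : Fin k} (hst : s ≠ t) :
    (∑ v : Fin k ⊕ Fin k → ZMod 2, if monskyMatrixOdd p *ᵥ v = 0 then v else 0) (Sum.inl s) +
      (∑ v : Fin k ⊕ Fin k → ZMod 2, if monskyMatrixOdd p *ᵥ v = 0 then v else 0) (Sum.inr s) +
      ((∑ v : Fin k ⊕ Fin k → ZMod 2, if monskyMatrixOdd p *ᵥ v = 0 then v else 0) (Sum.inl t) +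
        (∑ v : Fin k ⊕ Fin k → ZMod 2, if monskyMatrixOdd p *ᵥ v = 0 then v else 0) (Sum.inr t)) =
      ∑ B ∈ (univ : Finset (Fin k)).powerset.filter (fun B => s ∈ B ∧ t ∈ B ∧ (∏ i ∈ B, p i) % 8 = 5),
        (treeDet (fun i j => legendreMatrix p j i) B s + treeDet (fun i j => legendreMatrix p j i) B t) *
          (bigN (fun i j => legendreMatrix p j i) (univ \ B) (fun i => addLegendreSym 2 (p i))
            (fun i => addLegendreSym 2 (p i)) (fun i => addLegendreSym 2 (p i))).det := by
  rw [kerSum_monsky_four_eq_sum_admissible p hp hp2 hinj h5 hst]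
  exact sum_congr (filter_congr fun B _ => by rw [admissible_iff_prod_mod_eight p hp hp2 B]) fun _ _ => rfl

end Monsky


end Summit.BirchSwinnertonDyer.PrintCf2.QFormForest
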